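import Literature.NumberTheory.LFunctions.WeilMarkovQuadratic
import Literature.NumberTheory.LFunctions.WeilWindowSuzukiProofs
import Literature.NumberTheory.LFunctions.WeilWindowSuzukiContinuityProofs
import Literature.NumberTheory.LFunctions.WeilArchDensityTail
import Literature.NumberTheory.LFunctions.WeilMellinBounds
import Literature.NumberTheory.LFunctions.WeilArchimedeanMoments
import Summits.RiemannHypothesis.RiemannHypothesis.Theorems.WeilGroundStateGroundStateSimpleEvenKillingIntegral
import HarnessLib

/-!
# THETA kernel certificate, analytic layer D7: the ARCHIMEDEAN term of an autocorrelation (RH-FREE)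

Cell `rh-explicit`, WEIL column, seat handoff-prove-2 gen12; typing lane of `ThetaCertificateSound`
(THETA-KERNEL-BLUEPRINT v1.3 §3′/(P_R); THETA-CERT-cc6 §D7; director I l.7328 (A)(ii) «lane: D3/D4/D7/D8»).
Upper clauses of truncated Weil forms only; nothing here bears on the truth of RH.

For a Weil test function `g` (in the application: the mollified, compactly truncated odd theta tail
`T_R⁻ ⋆ moll_k`) with `‖g‖₂² ≤ A` and `‖g′‖₂² ≤ B`, and any `0 < t₀ ≤ 1`, the archimedean term of the
explicit formula at `k = g ⋆ g̃` satisfies, in the tree's normalisation (`weilArchTerm`, digamma form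
`= weilArchTermBombieri` by `weilArchTermBombieri_eq_weilArchTerm_holds`),

  `Re W_∞(g ⋆ g̃) ≤ B·(e^{t₀/2} t₀²/4) + A·max 0 (2·J̄(t₀) − (log 4π + γ) − (π/2 + log 2))`,

  `J̄(t₀) = log(1/t₀) + 1/2 + e^{1/2}/16 + 2·Σ_{k=0}^{5} e^{−(2k+½)}/(2k+½) + 2e^{−25/2}/((25/2)(1 − e^{−2}))`

(`re_weilArchTerm_weilConv_weilReflect_le_thetaCheck`) — symbol for symbol the `arch` line of cc-s2-1's
exact-ℚ checker `ThetaTier1Check.check` (`arch := Bhi/2·e^{t₀/2}·t₀·t₀/2 + Ahi·max 0 (2·Jhi − log 4π − γ − C₁)`,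
`C₁ = π/2 + log 2` EXACT by the tree's `GroundStateSimpleEven.kill_integral_weilKillingDensity_eq`).

Chain (all tree lemmas BY NAME): `Re W_∞(g⋆g̃) = −(log 4π + γ + π/2 + log 2)‖g‖₂² + ∫₀^∞ ρ_∞(t)D_t(g)dt`
(`weilArchTermBombieri_weilConv_weilReflect` + `integral_bombieriIntegrand_eq_sub` + the killing integral;
`ρ_∞ = weilArchDensity = e^{t/2}/(2 sinh t)`, `D_t = weilIncrement`); `D_t(g) ≤ t²‖g′‖₂²` (Plancherel:
`two_pi_mul_weilIncrement_eq`, `weilMellin_deriv`); `D_t ≤ 4‖g‖₂²` (`weilIncrement_le`); `ρ_∞(t) ≤ e^{t/2}/(2t)`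
(`weilArchDensity_le_exp_half_div`) on `(0, t₀]`; and the tail `2·weilArchTail t₀ = ∫_{t₀}^∞ e^{t/2}/sinh t ≤ J̄(t₀)`
(`sinh t ≥ t`, `e^{t/2} ≤ 1 + t/2 + 3t²/16` on `[t₀, 1]`; `ρ_∞ = q/(1 − q⁴)`, `q = e^{−t/2}`, six geometric terms and a
tail on `[1, ∞)`).  The sharper closed form `weilArchTail_eq` (`artanh(e^{−t₀/2}) + arctan(e^{−t₀/2})`) is in the
tree for whoever wants it; the checker's J̄ uses only `exp`/`log`.
-/

noncomputable section

set_option linter.dupNamespace false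

open Complex Set MeasureTheory Filter
open scoped Real Topology

namespace Summit.RiemannHypothesis.RiemannHypothesis.Theorems.WeilColumn.ThetaArch

open Literature.NumberTheory.LFunctions

variable {g : ℝ → ℂ}

/-! ## §1 The `L²`-modulus of a test function from its derivative: `D_h(g) ≤ h²‖g′‖₂²` -/

/-- `‖e^{ix} − 1‖² ≤ x²` (`‖e^{ix} − 1‖ = 2|sin(x/2)| ≤ |x|`). [folklore] -/
theorem norm_sq_exp_I_mul_sub_one_le (x : ℝ) : ‖cexp (I * x) - 1‖ ^ 2 ≤ x ^ 2 := by
  have h : ‖cexp (I * x) - 1‖ ≤ ‖x‖ := Real.norm_exp_I_mul_ofReal_sub_one_le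
  rw [Real.norm_eq_abs] at h
  calc ‖cexp (I * x) - 1‖ ^ 2 ≤ |x| ^ 2 := pow_le_pow_left₀ (norm_nonneg _) h 2
    _ = x ^ 2 := sq_abs x

/-- **`D_h(g) ≤ h²·‖g′‖₂²`** for a Weil test function `g` and every `h ∈ ℝ`: the `L²` translation modulus
`D_h(g) = ∫|g(x+h) − g(x)|²dx` through Plancherel (`2πD_h = ∫|e^{−iuh} − 1|²|ĝ(½+iu)|²du`,
`|e^{−iuh} − 1|² ≤ u²h²`, `u²|ĝ(½+iu)|² = |(g′)^(½+iu)|²`, `∫|(g′)^(½+iu)|² = 2π‖g′‖₂²`). [folklore] -/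
theorem weilIncrement_le_sq_mul_integral_deriv (hg : IsWeilTest g) (h : ℝ) :
    weilIncrement g h ≤ h ^ 2 * ∫ x : ℝ, ‖deriv g x‖ ^ 2 := by
  have hP := two_pi_mul_weilIncrement_eq hg h
  have hD : ∫ u : ℝ, ‖weilMellin (deriv g) (1 / 2 + u * I)‖ ^ 2 =
      2 * π * weilNorm2Sq (deriv g) := integral_norm_sq_weilMellin_half_line hg.deriv
  have hint : Integrable fun u : ℝ ↦ h ^ 2 * ‖weilMellin (deriv g) (1 / 2 + u * I)‖ ^ 2 :=
    (integrable_norm_sq_weilMellin_half_line hg.deriv).const_mul _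
  have hpt : ∀ u : ℝ, ‖cexp (I * ((-(u * h) : ℝ) : ℂ)) - 1‖ ^ 2 * ‖weilMellin g (1 / 2 + u * I)‖ ^ 2 ≤
      h ^ 2 * ‖weilMellin (deriv g) (1 / 2 + u * I)‖ ^ 2 := by
    intro u
    rw [weilMellin_deriv hg, norm_mul, mul_pow,
      show -((1 / 2 : ℂ) + u * I - 1 / 2) = ((-u : ℝ) : ℂ) * I by push_cast; ring, norm_mul,
      Complex.norm_I, mul_one, Complex.norm_real, Real.norm_eq_abs, sq_abs, neg_sq]
    have h1 := norm_sq_exp_I_mul_sub_one_le (-(u * h))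
    have h2 : 0 ≤ ‖weilMellin g (1 / 2 + u * I)‖ ^ 2 := sq_nonneg _
    calc ‖cexp (I * ((-(u * h) : ℝ) : ℂ)) - 1‖ ^ 2 * ‖weilMellin g (1 / 2 + u * I)‖ ^ 2
        ≤ (-(u * h)) ^ 2 * ‖weilMellin g (1 / 2 + u * I)‖ ^ 2 := mul_le_mul_of_nonneg_right h1 h2
      _ = h ^ 2 * (u ^ 2 * ‖weilMellin g (1 / 2 + u * I)‖ ^ 2) := by ring
  have hle : ∫ u : ℝ, ‖cexp (I * ((-(u * h) : ℝ) : ℂ)) - 1‖ ^ 2 * ‖weilMellin g (1 / 2 + u * I)‖ ^ 2 ≤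
      ∫ u : ℝ, h ^ 2 * ‖weilMellin (deriv g) (1 / 2 + u * I)‖ ^ 2 :=
    integral_mono_of_nonneg (Eventually.of_forall fun u ↦ by positivity) hint (Eventually.of_forall hpt)
  rw [← hP, integral_const_mul, hD] at hle
  unfold weilNorm2Sq at hle
  have hπ : 0 < 2 * π := by positivity
  have hle' : 2 * π * weilIncrement g h ≤ 2 * π * (h ^ 2 * ∫ x : ℝ, ‖deriv g x‖ ^ 2) := by
    linarith [hle]
  exact le_of_mul_le_mul_left hle' hπ

/-! ## §2 The archimedean energy on an `L²`-modulus class, split at `t₀` -/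

/-- **The archimedean energy split at `t₀`**: if `D_t(g) ≤ Bt²` for `0 < t ≤ t₀`, then
`∫₀^∞ ρ_∞(t)D_t(g)dt ≤ B·e^{t₀/2}t₀²/4 + 4‖g‖₂²·Ψ(t₀)`, `Ψ(t₀) = weilArchTail t₀ = ∫_{t₀}^∞ ρ_∞`
(`ρ_∞(t) ≤ e^{t/2}/(2t)` on the small scales, `D_t ≤ 4‖g‖₂²` on the large ones). [folklore; THETA-CERT-cc6 §D7] -/
theorem archEnergy_le_of_sq_modulus (hg : IsWeilTest g) {B t₀ : ℝ} (ht₀ : 0 < t₀)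
    (hB : ∀ t ∈ Ioc (0 : ℝ) t₀, weilIncrement g t ≤ B * t ^ 2) :
    ∫ t in Ioi (0 : ℝ), weilArchDensity t * weilIncrement g t ≤
      B * (Real.exp (t₀ / 2) * t₀ ^ 2 / 4) + 4 * (∫ x : ℝ, ‖g x‖ ^ 2) * weilArchTail t₀ := by
  set N := ∫ x : ℝ, ‖g x‖ ^ 2 with hN
  have hI := integrableOn_weilArchDensity_mul_weilIncrement hg
  have hB0 : 0 ≤ B := by
    have h1 := hB t₀ ⟨ht₀, le_rfl⟩
    have h2 := weilIncrement_nonneg g t₀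
    have ht2 : 0 < t₀ ^ 2 := by positivity
    by_contra hc
    have hc' : B < 0 := lt_of_not_ge hc
    have : B * t₀ ^ 2 < 0 := mul_neg_of_neg_of_pos hc' ht2
    linarith
  rw [← Ioc_union_Ioi_eq_Ioi ht₀.le, setIntegral_union Ioc_disjoint_Ioi_same measurableSet_Ioi
    (hI.mono_set Ioc_subset_Ioi_self) (hI.mono_set (Ioi_subset_Ioi ht₀.le))]
  -- the small scales: `ρ_∞ D_t ≤ B t² e^{t/2}/(2t) ≤ (B e^{t₀/2}/2)·t`
  have hmaj : IntegrableOn (fun t : ℝ ↦ (B * Real.exp (t₀ / 2) / 2) * t) (Ioc 0 t₀) :=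
    ((continuous_const.mul continuous_id).integrableOn_Icc).mono_set Ioc_subset_Icc_self
  have h1 : ∫ t in Ioc (0 : ℝ) t₀, weilArchDensity t * weilIncrement g t
      ≤ ∫ t in Ioc (0 : ℝ) t₀, (B * Real.exp (t₀ / 2) / 2) * t := by
    refine setIntegral_mono_on (hI.mono_set Ioc_subset_Ioi_self) hmaj measurableSet_Ioc fun t ht ↦ ?_
    have ht0 : 0 < t := ht.1
    have hρ0 := (weilArchDensity_pos ht0).le
    have hρ := weilArchDensity_le_exp_half_div ht0
    have he : Real.exp (t / 2) ≤ Real.exp (t₀ / 2) := Real.exp_le_exp.2 (by linarith [ht.2])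
    calc weilArchDensity t * weilIncrement g t ≤ weilArchDensity t * (B * t ^ 2) :=
          mul_le_mul_of_nonneg_left (hB t ht) hρ0
      _ ≤ Real.exp (t / 2) / (2 * t) * (B * t ^ 2) := mul_le_mul_of_nonneg_right hρ (by positivity)
      _ = (B * Real.exp (t / 2) / 2) * t := by field_simp
      _ ≤ (B * Real.exp (t₀ / 2) / 2) * t := by gcongr
  have h1v : ∫ t in Ioc (0 : ℝ) t₀, (B * Real.exp (t₀ / 2) / 2) * t = B * (Real.exp (t₀ / 2) * t₀ ^ 2 / 4) := by
    rw [integral_const_mul, ← intervalIntegral.integral_of_le ht₀.le, integral_id]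
    ring
  -- the large scales: `ρ_∞ D_t ≤ 4‖g‖₂² ρ_∞`
  have h2 : ∫ t in Ioi t₀, weilArchDensity t * weilIncrement g t ≤ ∫ t in Ioi t₀, (4 * N) * weilArchDensity t := by
    refine setIntegral_mono_on (hI.mono_set (Ioi_subset_Ioi ht₀.le))
      ((integrableOn_weilArchDensity_Ioi ht₀).const_mul _) measurableSet_Ioi fun t ht ↦ ?_
    have ht0 : (0 : ℝ) < t := lt_trans ht₀ ht
    have hρ0 := (weilArchDensity_pos ht0).le
    calc weilArchDensity t * weilIncrement g t ≤ weilArchDensity t * (4 * N) :=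
          mul_le_mul_of_nonneg_left (weilIncrement_le hg t) hρ0
      _ = (4 * N) * weilArchDensity t := by ring
  rw [integral_const_mul] at h2
  unfold weilArchTail
  linarith

/-! ## §3 The tail `Ψ(t₀) = ∫_{t₀}^∞ e^{t/2}/(2 sinh t) dt` in the checker's `exp`/`log` currency -/

/-- On `(0, 1]`: `ρ_∞(t) ≤ 1/(2t) + 1/4 + 3t/32` (`sinh t ≥ t`, `e^{t/2} ≤ 1 + t/2 + 3t²/16` from `Real.exp_bound'`). [folklore] -/
theorem weilArchDensity_le_near {t : ℝ} (ht : 0 < t) (ht1 : t ≤ 1) :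
    weilArchDensity t ≤ 1 / (2 * t) + 1 / 4 + 3 * t / 32 := by
  have hρ := weilArchDensity_le_exp_half_div ht
  have he : Real.exp (t / 2) ≤ 1 + t / 2 + 3 * t ^ 2 / 16 := by
    have h := Real.exp_bound' (x := t / 2) (by positivity) (by linarith) (n := 2) two_pos
    simp only [Finset.sum_range_succ, Finset.sum_range_zero, Nat.factorial, pow_zero,
      Nat.cast_one, pow_one] at h
    norm_num at h
    nlinarith [h]
  calc weilArchDensity t ≤ Real.exp (t / 2) / (2 * t) := hρ
    _ ≤ (1 + t / 2 + 3 * t ^ 2 / 16) / (2 * t) := div_le_div_of_nonneg_right he (by positivity)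
    _ = 1 / (2 * t) + 1 / 4 + 3 * t / 32 := by field_simp; ring

/-- `∫_{t₀}^{1} ρ_∞ ≤ ½log(1/t₀) + 1/4 + 3/64` for `0 < t₀ ≤ 1` (a primitive of the majorant of
`weilArchDensity_le_near` is `½log t + t/4 + 3t²/64`). [folklore] -/
theorem setIntegral_weilArchDensity_Ioc_le {t₀ : ℝ} (ht₀ : 0 < t₀) (ht₀1 : t₀ ≤ 1) :
    ∫ t in Ioc t₀ 1, weilArchDensity t ≤ (1 / 2) * Real.log (1 / t₀) + 1 / 4 + 3 / 64 := by
  have hcont : ContinuousOn weilArchDensity (Icc t₀ 1) := by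
    have e : weilArchDensity = fun t : ℝ ↦ Real.exp (t / 2) / (2 * Real.sinh t) := rfl
    rw [e]
    refine ContinuousOn.div (by fun_prop) (by fun_prop) fun t ht ↦ ?_
    have : 0 < Real.sinh t := Real.sinh_pos_iff.2 (ht₀.trans_le ht.1)
    positivity
  have hmajc : Continuous fun t : ℝ ↦ 1 / 4 + 3 * t / 32 := by fun_prop
  set F : ℝ → ℝ := fun t ↦ (1 / 2) * Real.log t + t / 4 + 3 * t ^ 2 / 64 with hF
  have hderiv : ∀ t ∈ Ioo t₀ 1, HasDerivAt F (1 / (2 * t) + 1 / 4 + 3 * t / 32) t := by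
    intro t ht
    have ht0 : 0 < t := ht₀.trans ht.1
    have h1 : HasDerivAt (fun t : ℝ ↦ (1 / 2) * Real.log t) ((1 / 2) * t⁻¹) t :=
      (Real.hasDerivAt_log ht0.ne').const_mul _
    have h2 : HasDerivAt (fun t : ℝ ↦ t / 4) (1 / 4) t := by
      simpa using (hasDerivAt_id t).div_const 4
    have h3 : HasDerivAt (fun t : ℝ ↦ 3 * t ^ 2 / 64) (3 * (2 * t) / 64) t := by
      have := ((hasDerivAt_pow 2 t).const_mul 3).div_const 64
      simpa using this
    have h := (h1.add h2).add h3
    refine h.congr_deriv ?_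
    field_simp
    ring
  have hmaj_int : IntervalIntegrable (fun t : ℝ ↦ 1 / (2 * t) + 1 / 4 + 3 * t / 32) volume t₀ 1 := by
    refine ContinuousOn.intervalIntegrable ?_
    rw [uIcc_of_le ht₀1]
    refine ContinuousOn.add (ContinuousOn.add ?_ continuousOn_const) (by fun_prop)
    exact continuousOn_const.div (by fun_prop) fun t ht ↦ by
      have : 0 < t := ht₀.trans_le ht.1
      positivity
  have hmono : ∫ t in t₀..1, weilArchDensity t ≤ ∫ t in t₀..1, (1 / (2 * t) + 1 / 4 + 3 * t / 32) := by
    refine intervalIntegral.integral_mono_on ht₀1 (hcont.intervalIntegrable_of_Icc ht₀1) hmaj_int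
      fun t ht ↦ weilArchDensity_le_near (ht₀.trans_le ht.1) ht.2
  have hFTC : ∫ t in t₀..1, (1 / (2 * t) + 1 / 4 + 3 * t / 32) = F 1 - F t₀ := by
    refine intervalIntegral.integral_eq_sub_of_hasDerivAt_of_le ht₀1 ?_ hderiv hmaj_int
    refine ContinuousOn.add (ContinuousOn.add ?_ (by fun_prop)) (by fun_prop)
    exact (continuousOn_const.mul (Real.continuousOn_log.mono fun t ht ↦ (ht₀.trans_le ht.1).ne'))
  rw [← intervalIntegral.integral_of_le ht₀1]
  have hF1 : F 1 = 1 / 4 + 3 / 64 := by norm_num [hF]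
  have hFt : F t₀ = (1 / 2) * Real.log t₀ + t₀ / 4 + 3 * t₀ ^ 2 / 64 := rfl
  have hlog : Real.log (1 / t₀) = -Real.log t₀ := by rw [one_div, Real.log_inv]
  calc ∫ t in t₀..1, weilArchDensity t ≤ F 1 - F t₀ := hmono.trans hFTC.le
    _ ≤ (1 / 2) * Real.log (1 / t₀) + 1 / 4 + 3 / 64 := by
        rw [hF1, hFt, hlog]; nlinarith [sq_nonneg t₀]

/-- On `[1, ∞)`: with `q = e^{−t/2}`, `ρ_∞ = q/(1 − q⁴) = q(1 + q⁴ + ⋯ + q²⁰) + q²⁵/(1 − q⁴)` and `q⁴ ≤ e^{−2}`, so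
`ρ_∞(t) ≤ Σ_{k=0}^{5} e^{−(2k+½)t} + e^{−(25/2)t}/(1 − e^{−2})`. [folklore] -/
theorem weilArchDensity_le_far {t : ℝ} (ht : 1 ≤ t) :
    weilArchDensity t ≤
      (∑ k ∈ Finset.range 6, Real.exp ((-((4 * (k : ℝ) + 1) / 2)) * t)) +
        Real.exp ((-(25 / 2 : ℝ)) * t) / (1 - Real.exp (-2)) := by
  have ht0 : 0 < t := by linarith
  set q : ℝ := Real.exp (-(t / 2)) with hq
  have hq0 : 0 < q := Real.exp_pos _
  have hq4 : q ^ 4 = Real.exp (-(2 * t)) := by rw [hq, ← Real.exp_nat_mul]; congr 1; push_cast; ring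
  have hq4le : q ^ 4 ≤ Real.exp (-2) := by rw [hq4]; exact Real.exp_le_exp.2 (by linarith)
  have he2 : Real.exp (-2) < 1 := Real.exp_lt_one_iff.2 (by norm_num)
  have hq4lt : q ^ 4 < 1 := lt_of_le_of_lt hq4le he2
  have hden : 0 < 1 - q ^ 4 := by linarith
  have hden2 : 0 < 1 - Real.exp (-2) := by linarith
  have hρ : weilArchDensity t = q / (1 - q ^ 4) := weilArchDensity_eq_of_exp_neg_half ht0.ne'
  -- the powers of `q` as exponentials in `t`
  have hpow : ∀ n : ℕ, q ^ n = Real.exp ((-((n : ℝ) / 2)) * t) := by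
    intro n
    rw [hq, ← Real.exp_nat_mul]; congr 1; ring
  have hsum : (∑ k ∈ Finset.range 6, Real.exp ((-((4 * (k : ℝ) + 1) / 2)) * t)) =
      ∑ k ∈ Finset.range 6, q ^ (4 * k + 1) := by
    refine Finset.sum_congr rfl fun k _ ↦ ?_
    rw [hpow]; congr 2; push_cast; ring
  have h25 : Real.exp ((-(25 / 2 : ℝ)) * t) = q ^ 25 := by rw [hpow]; norm_num
  rw [hρ, hsum, h25]
  -- algebra: q/(1−q⁴) = q(1 + q⁴ + … + q²⁰) + q²⁵/(1−q⁴)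
  have hid : q / (1 - q ^ 4) = (∑ k ∈ Finset.range 6, q ^ (4 * k + 1)) + q ^ 25 / (1 - q ^ 4) := by
    simp only [Finset.sum_range_succ, Finset.sum_range_zero]
    field_simp
    ring
  rw [hid]
  have htail : q ^ 25 / (1 - q ^ 4) ≤ q ^ 25 / (1 - Real.exp (-2)) :=
    div_le_div_of_nonneg_left (by positivity) hden2 (by linarith)
  linarith

/-- `∫_{1}^{∞} e^{−ct} dt = e^{−c}/c` for `c > 0`. [folklore] -/
theorem setIntegral_exp_neg_mul_Ioi_one {c : ℝ} (hc : 0 < c) :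
    ∫ t in Ioi (1 : ℝ), Real.exp (-c * t) = Real.exp (-c) / c := by
  rw [integral_exp_mul_Ioi (neg_lt_zero.2 hc) 1, mul_one, neg_div_neg_eq]

/-- `∫_{1}^{∞} ρ_∞ ≤ Σ_{k=0}^{5} e^{−(2k+½)}/(2k+½) + e^{−25/2}/((25/2)(1 − e^{−2}))`, written out term by term. [folklore] -/
theorem setIntegral_weilArchDensity_Ioi_one_le :
    ∫ t in Ioi (1 : ℝ), weilArchDensity t ≤
      (Real.exp (-1 / 2) / (1 / 2) + Real.exp (-5 / 2) / (5 / 2) + Real.exp (-9 / 2) / (9 / 2) +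
        Real.exp (-13 / 2) / (13 / 2) + Real.exp (-17 / 2) / (17 / 2) + Real.exp (-21 / 2) / (21 / 2)) +
      Real.exp (-25 / 2) / ((25 / 2) * (1 - Real.exp (-2))) := by
  have he2 : Real.exp (-2) < 1 := Real.exp_lt_one_iff.2 (by norm_num)
  have hden2 : 0 < 1 - Real.exp (-2) := by linarith
  -- integrability of the majorant
  have hik : ∀ k ∈ Finset.range 6,
      IntegrableOn (fun t : ℝ ↦ Real.exp ((-((4 * (k : ℝ) + 1) / 2)) * t)) (Ioi 1) := by
    intro k _
    exact exp_neg_integrableOn_Ioi 1 (by positivity)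
  have hisum : IntegrableOn
      (fun t : ℝ ↦ ∑ k ∈ Finset.range 6, Real.exp ((-((4 * (k : ℝ) + 1) / 2)) * t)) (Ioi 1) :=
    integrable_finsetSum (Finset.range 6) hik
  have hitail : IntegrableOn (fun t : ℝ ↦ Real.exp ((-(25 / 2 : ℝ)) * t) / (1 - Real.exp (-2))) (Ioi 1) :=
    (exp_neg_integrableOn_Ioi 1 (by positivity)).div_const _
  have hmono : ∫ t in Ioi (1 : ℝ), weilArchDensity t ≤
      ∫ t in Ioi (1 : ℝ), ((∑ k ∈ Finset.range 6, Real.exp ((-((4 * (k : ℝ) + 1) / 2)) * t)) +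
        Real.exp ((-(25 / 2 : ℝ)) * t) / (1 - Real.exp (-2))) :=
    setIntegral_mono_on (integrableOn_weilArchDensity_Ioi one_pos) (hisum.add hitail) measurableSet_Ioi
      fun t ht ↦ weilArchDensity_le_far (le_of_lt ht)
  refine hmono.trans (le_of_eq ?_)
  rw [integral_add hisum hitail, integral_finsetSum _ hik, integral_div]
  have hterm : ∀ k ∈ Finset.range 6, ∫ t in Ioi (1 : ℝ), Real.exp ((-((4 * (k : ℝ) + 1) / 2)) * t) =
      Real.exp (-((4 * (k : ℝ) + 1) / 2)) / ((4 * (k : ℝ) + 1) / 2) := by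
    intro k _
    exact setIntegral_exp_neg_mul_Ioi_one (by positivity)
  rw [Finset.sum_congr rfl hterm, setIntegral_exp_neg_mul_Ioi_one (by norm_num)]
  simp only [Finset.sum_range_succ, Finset.sum_range_zero]
  have e1 : Real.exp (-((4 * ((0 : ℕ) : ℝ) + 1) / 2)) / ((4 * ((0 : ℕ) : ℝ) + 1) / 2) =
      Real.exp (-1 / 2) / (1 / 2) := by norm_num [neg_div]
  have e2 : Real.exp (-((4 * ((1 : ℕ) : ℝ) + 1) / 2)) / ((4 * ((1 : ℕ) : ℝ) + 1) / 2) =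
      Real.exp (-5 / 2) / (5 / 2) := by norm_num [neg_div]
  have e3 : Real.exp (-((4 * ((2 : ℕ) : ℝ) + 1) / 2)) / ((4 * ((2 : ℕ) : ℝ) + 1) / 2) =
      Real.exp (-9 / 2) / (9 / 2) := by norm_num [neg_div]
  have e4 : Real.exp (-((4 * ((3 : ℕ) : ℝ) + 1) / 2)) / ((4 * ((3 : ℕ) : ℝ) + 1) / 2) =
      Real.exp (-13 / 2) / (13 / 2) := by norm_num [neg_div]
  have e5 : Real.exp (-((4 * ((4 : ℕ) : ℝ) + 1) / 2)) / ((4 * ((4 : ℕ) : ℝ) + 1) / 2) =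
      Real.exp (-17 / 2) / (17 / 2) := by norm_num [neg_div]
  have e6 : Real.exp (-((4 * ((5 : ℕ) : ℝ) + 1) / 2)) / ((4 * ((5 : ℕ) : ℝ) + 1) / 2) =
      Real.exp (-21 / 2) / (21 / 2) := by norm_num [neg_div]
  have e7 : Real.exp (-(25 / 2 : ℝ)) / (25 / 2) / (1 - Real.exp (-2)) =
      Real.exp (-25 / 2) / ((25 / 2) * (1 - Real.exp (-2))) := by
    rw [div_div, neg_div]
  rw [e1, e2, e3, e4, e5, e6, e7, zero_add]

/-- **The archimedean tail in the checker's currency**: for `0 < t₀ ≤ 1`,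
`2Ψ(t₀) = ∫_{t₀}^∞ e^{t/2}/sinh t dt ≤ J̄(t₀) := log(1/t₀) + 1/2 + e^{1/2}/16 + 2Σ_{k=0}^{5} e^{−(2k+½)}/(2k+½)
+ 2e^{−25/2}/((25/2)(1 − e^{−2}))` (THETA-CERT-cc6 §D7's `J(t₀)`; `ThetaTier1Check`'s `Jhi` with `log(1/t₀) = k·log 2`
at `t₀ = 2^{−k}`). [folklore; THETA-CERT-cc6 §D7] -/
theorem two_mul_weilArchTail_le {t₀ : ℝ} (ht₀ : 0 < t₀) (ht₀1 : t₀ ≤ 1) :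
    2 * weilArchTail t₀ ≤
      Real.log (1 / t₀) + 1 / 2 + Real.exp (1 / 2) / 16 +
        2 * (Real.exp (-1 / 2) / (1 / 2) + Real.exp (-5 / 2) / (5 / 2) + Real.exp (-9 / 2) / (9 / 2) +
          Real.exp (-13 / 2) / (13 / 2) + Real.exp (-17 / 2) / (17 / 2) + Real.exp (-21 / 2) / (21 / 2)) +
        2 * Real.exp (-25 / 2) / ((25 / 2) * (1 - Real.exp (-2))) := by
  have hI := integrableOn_weilArchDensity_Ioi ht₀
  have hsplit : weilArchTail t₀ = (∫ t in Ioc t₀ 1, weilArchDensity t) + ∫ t in Ioi (1 : ℝ), weilArchDensity t := by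
    unfold weilArchTail
    rw [← Ioc_union_Ioi_eq_Ioi ht₀1, setIntegral_union Ioc_disjoint_Ioi_same measurableSet_Ioi
      (hI.mono_set Ioc_subset_Ioi_self) (hI.mono_set (Ioi_subset_Ioi ht₀1))]
  have h1 := setIntegral_weilArchDensity_Ioc_le ht₀ ht₀1
  have h2 := setIntegral_weilArchDensity_Ioi_one_le
  have he : (3 : ℝ) / 2 ≤ Real.exp (1 / 2) := by
    have := Real.add_one_le_exp (1 / 2 : ℝ)
    linarith
  rw [hsplit, mul_div_assoc]
  linarith [h1, h2, he]

/-! ## §4 Assembly: the archimedean term of an autocorrelation -/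

/-- **The archimedean term through the increment energy, exactly**: for a Weil test function `g`,
`Re W_∞(g ⋆ g̃) = −(log 4π + γ + π/2 + log 2)·‖g‖₂² + ∫₀^∞ ρ_∞(t) D_t(g) dt`
(Bombieri's form = the digamma form on test functions; killing integral `∫₀^∞(e^{t/2} − 1)/(2 sinh t) = π/4 + ½log 2`).
[cite: Bombieri2000Weil, Thm 2 (p. 193); folklore] -/
theorem re_weilArchTerm_weilConv_weilReflect_eq (hg : IsWeilTest g) :
    (weilArchTerm (weilConv g (weilReflect g))).re =
      -(Real.log (4 * π) + Real.eulerMascheroniConstant + (π / 2 + Real.log 2)) * (∫ x : ℝ, ‖g x‖ ^ 2) +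
        ∫ t in Ioi (0 : ℝ), weilArchDensity t * weilIncrement g t := by
  have hk : IsWeilTest (weilConv g (weilReflect g)) := hg.weilConv hg.weilReflect
  rw [← weilArchTermBombieri_eq_weilArchTerm_holds hk, weilArchTermBombieri_weilConv_weilReflect hg,
    Complex.ofReal_re, integral_bombieriIntegrand_eq_sub hg,
    GroundStateSimpleEven.kill_integral_weilKillingDensity_eq]
  ring

/-- **D7 (modulus form)**: if `‖g‖₂² ≤ A` and `D_t(g) ≤ Bt²` on `(0, t₀]`, then
`Re W_∞(g ⋆ g̃) ≤ B·e^{t₀/2}t₀²/4 + A·max 0 (4Ψ(t₀) − (log 4π + γ) − (π/2 + log 2))`. [THETA-CERT-cc6 §D7, tree form] -/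
theorem re_weilArchTerm_weilConv_weilReflect_le_of_sq_modulus (hg : IsWeilTest g) {A B t₀ : ℝ}
    (hA : ∫ x : ℝ, ‖g x‖ ^ 2 ≤ A) (ht₀ : 0 < t₀)
    (hB : ∀ t ∈ Ioc (0 : ℝ) t₀, weilIncrement g t ≤ B * t ^ 2) :
    (weilArchTerm (weilConv g (weilReflect g))).re ≤
      B * (Real.exp (t₀ / 2) * t₀ ^ 2 / 4) +
        A * max 0 (4 * weilArchTail t₀ - (Real.log (4 * π) + Real.eulerMascheroniConstant) - (π / 2 + Real.log 2)) := by
  set N := ∫ x : ℝ, ‖g x‖ ^ 2 with hN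
  set c := 4 * weilArchTail t₀ - (Real.log (4 * π) + Real.eulerMascheroniConstant) - (π / 2 + Real.log 2) with hc
  have hN0 : 0 ≤ N := integral_nonneg fun x ↦ by positivity
  have hE := archEnergy_le_of_sq_modulus hg ht₀ hB
  rw [re_weilArchTerm_weilConv_weilReflect_eq hg]
  have h1 : N * c ≤ N * max 0 c := mul_le_mul_of_nonneg_left (le_max_right _ _) hN0
  have h2 : N * max 0 c ≤ A * max 0 c := mul_le_mul_of_nonneg_right hA (le_max_left _ _)
  have : -(Real.log (4 * π) + Real.eulerMascheroniConstant + (π / 2 + Real.log 2)) * N +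
      (B * (Real.exp (t₀ / 2) * t₀ ^ 2 / 4) + 4 * N * weilArchTail t₀) =
        B * (Real.exp (t₀ / 2) * t₀ ^ 2 / 4) + N * c := by rw [hc]; ring
  linarith

/-- **D7 (derivative form)**: if `‖g‖₂² ≤ A` and `‖g′‖₂² ≤ B`, then for every `t₀ > 0`
`Re W_∞(g ⋆ g̃) ≤ B·e^{t₀/2}t₀²/4 + A·max 0 (4Ψ(t₀) − (log 4π + γ) − (π/2 + log 2))`,
`Ψ = weilArchTail` (closed form `weilArchTail_eq`). [THETA-CERT-cc6 §D7, tree form] -/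
theorem re_weilArchTerm_weilConv_weilReflect_le (hg : IsWeilTest g) {A B t₀ : ℝ}
    (hA : ∫ x : ℝ, ‖g x‖ ^ 2 ≤ A) (hB : ∫ x : ℝ, ‖deriv g x‖ ^ 2 ≤ B) (ht₀ : 0 < t₀) :
    (weilArchTerm (weilConv g (weilReflect g))).re ≤
      B * (Real.exp (t₀ / 2) * t₀ ^ 2 / 4) +
        A * max 0 (4 * weilArchTail t₀ - (Real.log (4 * π) + Real.eulerMascheroniConstant) - (π / 2 + Real.log 2)) := by
  refine re_weilArchTerm_weilConv_weilReflect_le_of_sq_modulus hg hA ht₀ fun t _ ↦ ?_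
  have h := weilIncrement_le_sq_mul_integral_deriv hg t
  have ht2 : 0 ≤ t ^ 2 := sq_nonneg t
  calc weilIncrement g t ≤ t ^ 2 * ∫ x : ℝ, ‖deriv g x‖ ^ 2 := h
    _ ≤ t ^ 2 * B := mul_le_mul_of_nonneg_left hB ht2
    _ = B * t ^ 2 := mul_comm _ _

/-- **D7 IN THE CHECKER'S CURRENCY** (`ThetaTier1Check.check`, line `arch`): for a Weil test function `g` with
`‖g‖₂² ≤ A`, `‖g′‖₂² ≤ B` and any `0 < t₀ ≤ 1`,
`Re W_∞(g ⋆ g̃) ≤ B·(e^{t₀/2}·t₀²/4) + A·max 0 (2J̄(t₀) − (log 4π + γ) − (π/2 + log 2))` with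
`J̄(t₀) = log(1/t₀) + 1/2 + e^{1/2}/16 + 2Σ_{k=0}^{5}e^{−(2k+½)}/(2k+½) + 2e^{−25/2}/((25/2)(1 − e^{−2}))`.
RH-FREE bookkeeping; nothing here bears on the truth of RH. [THETA-CERT-cc6 §D7, tree form] -/
theorem re_weilArchTerm_weilConv_weilReflect_le_thetaCheck (hg : IsWeilTest g) {A B t₀ : ℝ}
    (hA : ∫ x : ℝ, ‖g x‖ ^ 2 ≤ A) (hB : ∫ x : ℝ, ‖deriv g x‖ ^ 2 ≤ B) (ht₀ : 0 < t₀) (ht₀1 : t₀ ≤ 1) :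
    (weilArchTerm (weilConv g (weilReflect g))).re ≤
      B * (Real.exp (t₀ / 2) * t₀ ^ 2 / 4) +
        A * max 0 (2 * (Real.log (1 / t₀) + 1 / 2 + Real.exp (1 / 2) / 16 +
          2 * (Real.exp (-1 / 2) / (1 / 2) + Real.exp (-5 / 2) / (5 / 2) + Real.exp (-9 / 2) / (9 / 2) +
            Real.exp (-13 / 2) / (13 / 2) + Real.exp (-17 / 2) / (17 / 2) + Real.exp (-21 / 2) / (21 / 2)) +
          2 * Real.exp (-25 / 2) / ((25 / 2) * (1 - Real.exp (-2))))
          - (Real.log (4 * π) + Real.eulerMascheroniConstant) - (π / 2 + Real.log 2)) := by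
  have hA0 : 0 ≤ A := le_trans (integral_nonneg fun x ↦ by positivity) hA
  have h := re_weilArchTerm_weilConv_weilReflect_le hg hA hB ht₀
  have hJ := two_mul_weilArchTail_le ht₀ ht₀1
  refine h.trans (add_le_add le_rfl (mul_le_mul_of_nonneg_left (max_le_max le_rfl ?_) hA0))
  rw [mul_div_assoc] at hJ ⊢
  linarith

end Summit.RiemannHypothesis.RiemannHypothesis.Theorems.WeilColumn.ThetaArch

end
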